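import Mathlib.RingTheory.MvPolynomial.Basic
import Mathlib.Algebra.MvPolynomial.Degrees
import Mathlib.Analysis.Complex.Basic
import Literature.Computability.AlgebraicComplexity.ValiantClasses
import Literature.Computability.AlgebraicComplexity.StandardFamilies
import HarnessLib

/-!
# Named fact: Raz's elusive-curve criterion, at the Sidon moment curve

Grounder file (D-0014 named facts) for the route `ValiantsHypothesis/Elusive`, statement item
stmt-ValiantsHypothesis-0341 (`elusive_raz_candidate`).

Raz (Theory of Computing 6 (2010) 135–177, abstract and §1; STOC 2008): a polynomial mapping
`f : 𝔽ⁿ → 𝔽^m` is `(s, r)`-elusive if `Im f ⊄ Im Γ` for every polynomial mapping `Γ : 𝔽^s → 𝔽^m`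
of degree `r`; "any explicit `f : ℂ → ℂ^m` [that is `(m−1, 2)`-elusive], with the right notion of
explicitness, of degree up to `2^{m^{o(1)}}`, implies super-polynomial lower bounds for computing
the permanent" over `ℂ`. The route's candidate is the monomial ("Sidon moment") curve
`x ↦ (x^{d_i})_{i<m}`, `d_i = (i+1)(2m²+1) + (i+1)²`, of degree `O(m³)`, whose exponent data are
computable in time polynomial in `log m` — explicit in every sense of Raz 2010 §1.2/§5, and of
degree far below `2^{m^{o(1)}}`. Hence IF this curve is `(m−1, 2)`-elusive for all large `m`, the
permanent family is not p-computable (`¬ IsVPFamily (fun n => perPoly (Fin n) ℂ)`). Whether the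
curve is elusive is the route's open crux; this fact only records Raz's implication.

Nothing is asserted; users take `(h : Literature.CplxAlg.raz_elusive_momentCurve)`.

## References

* R. Raz, *Elusive functions and lower bounds for arithmetic circuits*, Theory of Computing 6
  (2010), 135–177 (STOC 2008), abstract, §1.1–1.2, §4.
-/

noncomputable section

namespace Literature.Computability.AlgebraicComplexity

/-- NAMED FACT (Raz 2010, Theory Comput. 6, abstract/§1: an explicit `(m−1,2)`-elusive curve
`ℂ → ℂ^m` of degree `≤ 2^{m^{o(1)}}` implies super-polynomial arithmetic-circuit lower bounds for
the permanent), instantiated at the explicit monomial curve with Sidon exponents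
`d_i = (i+1)(2m²+1) + (i+1)²`. If for all large `m` no quadratic polynomial map
`Γ : ℂ^{m−1} → ℂ^m` has image containing the curve, then the permanent family over `ℂ` is not a
`VP` family. Users take `(h : raz_elusive_momentCurve)`. [cite: Raz2010, abstract and §1 (main corollary for the permanent)] -/
def raz_elusive_momentCurve : Prop :=
  (∃ m₀ : ℕ, ∀ m ≥ m₀, ∀ Γ : Fin m → MvPolynomial (Fin (m - 1)) ℂ, (∀ i, (Γ i).totalDegree ≤ 2) →
      ¬ (Set.range (fun x : ℂ => fun i : Fin m => x ^ (((i : ℕ) + 1) * (2 * m ^ 2 + 1) + ((i : ℕ) + 1) ^ 2)) ⊆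
          Set.range (fun y : Fin (m - 1) → ℂ => fun i : Fin m => MvPolynomial.eval y (Γ i)))) →
    ¬ IsVPFamily (fun n => perPoly (Fin n) ℂ)

end Literature.Computability.AlgebraicComplexity

end
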